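/-
Copyright: lit-balaban Phase-2 proof seat p27 (gen 39).  Statement-level skeleton of a published paper; no proof claims beyond what the
kernel checks below.
-/
import Literature.MathematicalPhysics.QuantumFieldTheory.BalabanImbrieJaffe1984to88.BIJ88ClocEstimatesTorus
import Literature.MathematicalPhysics.QuantumFieldTheory.BalabanImbrieJaffe1984to88.BIJ85Eq531ProofPart2
import Literature.MathematicalPhysics.QuantumFieldTheory.BalabanImbrieJaffe1984to88.BIJ85CurlQsstar
import Literature.MathematicalPhysics.QuantumFieldTheory.BalabanImbrieJaffe1984to88.BIJ88Sect3Translations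
import Literature.MathematicalPhysics.QuantumFieldTheory.BalabanImbrieJaffe1984to88.BIJ88Eq531SmallF
import Literature.MathematicalPhysics.QuantumFieldTheory.BalabanImbrieJaffe1984to88.BIJ85TorusTentCutoff
import Literature.MathematicalPhysics.QuantumFieldTheory.Balaban1983to89.B3TorusRadialSums

/-!
# `BalabanImbrieJaffe1984to88.BIJ88Small333GaugeField` — T. Bałaban, J. Imbrie, A. Jaffe, *Effective action and cluster properties of the
abelian Higgs model*, Commun. Math. Phys. **114** (1988) 257–315 [BalabanImbrieJaffe1988], Sect. 3 pp. 269–270 [PDF 13–14]: THE SIZE of the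
correction `C^{(0)}_{loc}∂^*Q^{e*}f` of the second gauge-field translation (3.27), and the GAUGE-FIELD HALF of (3.33)
«|A^{(0)}| ≦ cp(e₀) in Λ₁^{(0)*}» PROVED on the torus of record (theorems only)

statement-level skeleton of published theorems with citation tags; proofs where landed; nothing here is a claim about the Yang–Mills mass gap

PDF held: `paper:balaban1988-cmp114-bij-abelian-higgs-effective-action` (journal page = PDF page + 256); pp. 269–270 [PDF 13–14] and p. 297
[PDF 41] read this session from the text layer (`lit read … `, files `p0013.txt`, `p0014.txt`, `p0041.txt`).

CITATION HEADER (lean-in-tree rule).  Part of the lit-balaban TYPED SKELETON (HOME `run/shared/lean/pub/lit-balaban/`), Phase 2, seat p27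
GEN 39 (unit `lit-balaban-p27`; free-target protocol G.5-34(d): TAKING line HOME/STATUS.md 2026-08-23T11:46:24Z, re-scoped 12:08Z to the
owner r18's split of 11:47:51Z — the (3.27)/(3.28) DEFINITIONS `corr327`/`corrOp` and their dictionary are p29 g33's
`BIJ88SecondTranslation327Torus` (TAKING 11:44:22Z); this file is theorems only and names no `corr327`); rows **C2.Eq3.33** (member) and
C2.Eq3.27 / C2.Eq3.28 (cells: the size of the correction) of `HOME/lit-balaban-r18/ROWS-C2.md` (C2 §§1–4 fold owner r18, referee ref-5);
the member is the one named OWED in r18's `AUDIT-C2S14-DEF-g26.md` row C2.Eq3.33 (the `A^{(0)}`-bound *"via (3.27) … with the ℓ¹-bounds of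
`Cloc`"*).

THE PRINTED TEXT (verbatim).  p. 269 [PDF 13]: *"A second translation is needed to remove the term linear in A′. We put
A′ = A^{(0)} − Λ₄^{(0)*}L^{−2}C^{(0)}_{loc}∂^*Q^{e*}f, (3.27) which does not precisely eliminate the linear term. However, it is local, and away
from ∂Λ₄^{(0)} the linear term is extremely small. … Let us write the background gauge field in Λ₃^{(0)*} in terms of A^{(0)}. It is
u = (Q^{s*}v) exp[ie₀(A^{(0)} − Λ₄^{(0)*}L^{−2}C^{(0)}_{loc}∂^*Q^{e*}f)]. (3.28)"*; p. 270 [PDF 14]: *"u₁ = (Λ₁^{(0)*}Q^{s*}v)(Λ₆^{(0)*c}u^{(0)})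
exp(ie₀Λ₄^{(0)*}L^{−2}C^{(0)}_{loc}∂^*Q^{e*}f). … Similarly, it can be shown that |A^{(0)}| ≦ cp(e₀) in Λ₁^{(0)*}, |φ^{(0)}| ≦ cp(e₀) in
Λ₁^{(0)*}, (3.33) and we inset a factor χ′_{Λ₇^{(0)}} enforcing these bounds in Λ₇^{(0)}."*; the general-step twin, p. 297 [PDF 41]: *"We remarked
earlier that A′ is small in Λ₁^{(k)*}. We then defined A^{(k)} = A′ + … f. Since f is small and H_{k,loc} is regular, we have that
|A^{(k)}| ≦ cp(e_k), b ∈ Λ₇^{(k)*}. (5.9.4)"*.  The print gives no further proof of the `A^{(0)}`-half of (3.33); the mechanism formalized here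
is the one the general step names: `A^{(0)} = A′ + Λ₄^{(0)*}L^{−2}C^{(0)}_{loc}∂^*Q^{e*}f` by (3.27), `|A′_b| ≦ cp(e₀)` on `Λ₁^{(0)*}` (p. 269,
*"From the restrictions on the fields, we have that u′_b = e^{ie₀A′_b}, with |A′_b| ≦ cp(e₀) in Λ₁^{(0)*}"*), `|f(p)| ≦ cp(e₀)` (by (3.15)),
and `C^{(0)}_{loc}`, `∂^*`, `Q^{e*}` are local operators with `ℓ^∞ → ℓ^∞` norms bounded in terms of `(d, L)` only (the factor `L²` of
`Q^{e*}` ([BalabanImbrieJaffe1985] (2.22)) against the `L^{−2}` of (3.27)).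

THE OBJECTS (all OF RECORD, consumed BY NAME; tori of `Balaban1983to89.Setup`, unit lattice `T₁ = T^{(j)}` with bonds `PBond P j` and
plaquettes `Plaq P j`, block lattice `T^{(j+1)}`, standing range `j + 1 ≤ m + K`; `d = P.d` the lattice dimension):
* the correction of (3.27) is written throughout as the CLOSED EXPRESSION
  `(Cloc P j R).mulVec (plaqDiv 1 ((torusEdgeCells P j hd).Qstar f)) b = Σ_{b′} C^{(0)}_{loc}(b,b′)·(∂^*Q^{e*}f)(b′)` (no definition is made
  here; p29's `corr327`/`corrOp` of `BIJ88SecondTranslation327Torus` are this expression at `f = (ie₀)^{−1}log v(∂·)`), where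
  `C^{(0)}_{loc}` = p09's (2.9) kernel `BIJ88ClocEstimatesTorus.Cloc P j R` (truncation radius `R`, print's `R = ¼r(e₀)`) with its
  hypothesis-free estimates `cloc_decay` (`|C_loc(b,b′)| ≤ M′e^{−δ′|b−b′|_∞}`, `M′, δ′ > 0` from `(d, L)` only) and `cloc_eq_zero_of_far`
  (`C_loc(b,b′) = 0` for `|b − b′|_∞ > R + 4L`), `∂^*` = `BIJ85Eq531Proof.plaqDiv 1`, the transpose of `LatticeFieldCalculus.curl 1`
  ([BalabanImbrieJaffe1985] (4.2.2); local formula `BIJ85Eq531ProofPart2.plaqDiv_apply`), and `Q^{e*}` =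
  `(BIJ85CurlQsstar.torusEdgeCells P j hd).Qstar` ([BalabanImbrieJaffe1985] (2.22): `(Q^{e*}f)(p) = L²f(p′)` on `B^e(p′)`, `0` otherwise);
* (3.27) = r18's `BIJ88Sect3Translations.Aprime327` (`A′ = A^{(0)} − Λ₄*L^{−2}corr` over the data `corr`); (3.33) = r18's
  `BIJ88Sect3Statements.Small333` (its first clause is what is proved, on the bonds of `Λ₁*`); `|A′_b| ≤ c·p(e₀)` = r16's predicate
  `BIJ88Sect5StatementsPart3.SmallAPrime`; `Λ**` = r18's `BIJ88Sect3Statements.starP`; §4 consumes p31's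
  `BIJ88Eq531SmallAPrime.smallAPrime_of_plaquettes` and `BIJ88Eq531SmallF.smallF_of_plaquettes`.

WHAT IS PROVED (0 `sorry`, standard axioms, NO definitions, no named facts).
* §0 kernels: `abs_plaqDiv_le_of_near` (`|(∂^*g)(b)| ≤ |c|·4d·G` when `|g| ≤ G` on the plaquettes based within sup-distance `1` of `b₋`),
  `abs_edgeQstar_le` (`|(Q^{e*}f)(p)| ≤ L²|f(⟨blockOf p₋, μ, ν⟩)|`), the unit-lattice bond row sum; `a0_eq_aprime327_add` ((3.27) read for
  `A^{(0)}`: `A^{(0)} = A′ + Λ₄*L^{−2}corr`).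
* §1 **THE SIZE OF THE (3.27) CORRECTION** (p. 269 *"it is local"*; p. 297 *"Since f is small and H_{k,loc} is regular"*):
  `abs_clocCorr_le_of_bound` — under any bound `|C_loc(b,b′)| ≤ Me^{−δ|b−b′|_∞}`,
  `|Σ_{b′}C_loc(b,b′)(∂^*Q^{e*}f)(b′)| ≤ M·d(2(1+d/δ))^d·4d·L²·F` whenever `|f(q)| ≤ F` for every coarse plaquette `q` based at a block met
  within sup-distance `R + 4L + 1` of `b₋`; **`clocCorr_bound`** — the same with ONE constant `C = C(d, L)` for every torus of these `(d, L)`,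
  every `j + 1 ≤ m + K`, every `R` (p09's `cloc_decay`): `≤ C·L²·F`; locality `clocCorr_eq_zero_of_far`.
* §2 **(3.33), GAUGE-FIELD HALF**: `small333_gauge_of_corr` (abstract correction `corr`: `SmallAPrime c₁ pe₀ Λ₁* (Aprime327 Λ₄* L A^{(0)}
  corr)` + `|corr_b| ≤ X·L²·c₂p(e₀)` on `Λ₁* ∩ Λ₄*` ⟹ `|A^{(0)}_b| ≤ (c₁ + Xc₂)p(e₀)` on `Λ₁*`), `small333_gauge_of_bound` (the correction OF
  RECORD: kernel bound + `|f(q)| ≤ c₂p(e₀)` on `Λ₀′**` + THE LOCATED MARGIN «every coarse plaquette based at a block met within sup-distance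
  `R + 4L + 1` of a bond of `Λ₁* ∩ Λ₄*` lies in `Λ₀′**`» — print: `Λ₁^{(0)}` is `Λ₀^{(0)}` with `r(e₀)`-cubes deleted at the boundary, p. 267,
  `R = ¼r(e₀)`), **`small333_gauge`** (uniform: **`∀ b ∈ Λ₁*, |A^{(0)}_b| ≤ (c₁ + C·c₂)·p(e₀)`**, `C = C(d, L)`) — the first clause of r18's
  `Small333` on the bonds of `Λ₁*`.
* §3 the p. 270 correction factor of the background `u₁`: `‖exp(−ie₀L^{−2}Σ_{b′}C_loc(b,b′)(∂^*Q^{e*}f)(b′)) − 1‖ ≤ e₀·C·c₂·p(e₀)`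
  (`norm_corrPhase_sub_one_le` / `_uniform`) — the size modulo which p30 g32's `BIJ88SmallBlockFields332` states the `D_{ū₁}ψ` clause of (3.32).
* §4 **THE PLAQUETTE-LEVEL INSTANCE** `small333_gauge_of_plaquettes` / `_uniform`: for a `U(1)` field in the axial gauge `δ_{Ax}` (3.11) whose
  fine plaquettes near `Λ₁*` and around `Λ₀′**` obey `|arg u(p)| ≤ e₀p(e₀)` (`17d²L²e₀p(e₀) < π`), print's `A′_b = arg(u′_b)/e₀` and
  `f = Re (ie₀)^{−1}log(Qu)(∂·)` — p31's `smallAPrime_of_plaquettes` (`c₁ = 6d²L²`) and `smallF_of_plaquettes` (`c₂ = 17d²L²`) BY NAME — and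
  any `A^{(0)}` tied to that `A′` by (3.27): `∀ b ∈ Λ₁*, |A^{(0)}_b| ≤ c(d, L)·p(e₀)`.
HONEST SCOPE.  (i) Only the `A^{(0)}`-half of (3.33) is claimed; the `φ^{(0)}`-half (*"|φ^{(0)}| ≦ cp(e₀)"*; general step (5.9.5) p. 297
via [8] = [BalabanImbrieJaffe1985] (2.113)) is a propagator argument NOT reproduced here.  (ii) `A^{(0)}` enters as any bond function tied
to print's `A′` by r18's typed (3.27) (`Aprime327 Λ₄* L A^{(0)} corr = A′`; r18 types `A′` as a function of `A^{(0)}`), i.e. the new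
integration variable of the second translation; `f` is real (`Re` of r18's principal-branch `fieldStrength`, which is real on the unit
circle, p31's `norm_fieldStrength_eq`); the (3.27)/(3.28) displays at the correction are p29's file, not restated.  (iii) Constants
existential in `(d, L)` through (7.2.3) (p09's `cloc_decay`), uniform in the torus, in `j` and in `R` as printed ("c"); not optimized
(`|∂^*g| ≤ 4d‖g‖` is used where `2(d−1)` would do).  (iv) The located margin is stated as a hypothesis on the regions, not derived from a
typed region tower.  (v) `d = P.d ≥ 2` (the edge-plaquette carrier needs it); every `L`.  Literature + Mathlib only; no Summits import.
Unit `lit-balaban-p27` (literature-prover-lit-balaban-p27-g39-0), 2026-08-23.  NOT summit progress, continuum or Clay.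
-/

open scoped BigOperators Matrix
open Finset

namespace Literature.MathematicalPhysics.QuantumFieldTheory.BalabanImbrieJaffe1984to88.BIJ88Small333GaugeField

open Literature.MathematicalPhysics.QuantumFieldTheory.Balaban1983to89
open LatticeFieldCalculus (supDist curl)
open BIJ85Eq531Proof (plaqDiv)
open BIJ85Eq531ProofPart2 (plaqDiv_apply)
open BIJ85CurlQsstar (torusEdgeCells mem_edgeB_iff)
open BIJ88ClocEstimatesTorus (Cloc cloc_decay cloc_eq_zero_of_far)
open BIJ88ClocFactorsTorus (distB distB_apply)
open BIJ88Sect3Translations (Aprime327)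
open BIJ88Sect3Statements (starP)
open BIJ88Sect5StatementsPart3 (SmallAPrime)
open B3TorusRadialSums (sum_exp_neg_supDist_le supDist_eq_zero_iff)
open BIJ85TorusTentCutoff (supDist_unshift_le_succ)
open BIJ85Ineq722Torus (supDist_triangle)

noncomputable section

variable {P : Params} {j : ℕ}

/-! ## §0  Kernels: the `ℓ^∞ → ℓ^∞` sizes of `∂^*` and `Q^{e*}`, the bond row sum, (3.27) read for `A^{(0)}` -/

/-- kernel: `|x − (x − e_ν)|_∞ ≤ 1`. [folklore] -/
private theorem supDist_unshift_le_one (x : Balaban1983to89.Site P j) (ν : Fin P.d) : supDist x (x.unshift ν) ≤ 1 := by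
  have h := supDist_unshift_le_succ x x ν
  rwa [(supDist_eq_zero_iff x x).2 rfl, zero_add] at h

/-- **`∂^*` is bounded on `ℓ^∞`, locally**: for the bond `b = ⟨x, x + e_κ⟩`, if `|g(p)| ≤ G` for every plaquette `p` based within sup-distance
`1` of `x` (the `2(d−1)` plaquettes containing `b` are based at `x` or at `x − e_ν`; `d = P.d`), then `|(∂^*g)(b)| ≤ |c|·4d·G` — from the local
formula `plaqDiv_apply` of the transpose of `curl c` ([BalabanImbrieJaffe1985] (4.2.2) `σ_k = Q^e_k(I − ∂G_{k,Ax}∂^*)Q^{e*}_k`; here it sizes the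
`∂^*` of (3.27)). [cite: BalabanImbrieJaffe1988, (3.27) p.269] -/
theorem abs_plaqDiv_le_of_near (c : ℝ) (g : Balaban1983to89.Plaq P j → ℝ) (x : Balaban1983to89.Site P j) (κ : Fin P.d) {G : ℝ} (hG : 0 ≤ G)
    (hg : ∀ p : Balaban1983to89.Plaq P j, supDist x p.src ≤ 1 → |g p| ≤ G) :
    |plaqDiv c g ⟨x, κ⟩| ≤ |c| * (4 * P.d * G) := by
  have hx : supDist x x ≤ 1 := by rw [(supDist_eq_zero_iff x x).2 rfl]; exact zero_le_one
  rw [plaqDiv_apply, abs_mul]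
  refine mul_le_mul_of_nonneg_left ?_ (abs_nonneg c)
  have h1 : |∑ ν : Fin P.d, (if h : κ < ν then g ⟨x, κ, ν, h⟩ - g ⟨x.unshift ν, κ, ν, h⟩ else 0)| ≤ P.d * (2 * G) := by
    calc _ ≤ ∑ ν : Fin P.d, |(if h : κ < ν then g ⟨x, κ, ν, h⟩ - g ⟨x.unshift ν, κ, ν, h⟩ else 0)| := abs_sum_le_sum_abs _ _
      _ ≤ ∑ _ν : Fin P.d, 2 * G := sum_le_sum fun ν _ => by
          split_ifs with h
          · exact (abs_sub _ _).trans (by linarith [hg ⟨x, κ, ν, h⟩ hx, hg ⟨x.unshift ν, κ, ν, h⟩ (supDist_unshift_le_one x ν)])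
          · rw [abs_zero]; linarith
      _ = P.d * (2 * G) := by rw [sum_const, card_univ, Fintype.card_fin, nsmul_eq_mul]
  have h2 : |∑ μ : Fin P.d, (if h : μ < κ then g ⟨x.unshift μ, μ, κ, h⟩ - g ⟨x, μ, κ, h⟩ else 0)| ≤ P.d * (2 * G) := by
    calc _ ≤ ∑ μ : Fin P.d, |(if h : μ < κ then g ⟨x.unshift μ, μ, κ, h⟩ - g ⟨x, μ, κ, h⟩ else 0)| := abs_sum_le_sum_abs _ _
      _ ≤ ∑ _μ : Fin P.d, 2 * G := sum_le_sum fun μ _ => by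
          split_ifs with h
          · exact (abs_sub _ _).trans (by linarith [hg ⟨x.unshift μ, μ, κ, h⟩ (supDist_unshift_le_one x μ), hg ⟨x, μ, κ, h⟩ hx])
          · rw [abs_zero]; linarith
      _ = P.d * (2 * G) := by rw [sum_const, card_univ, Fintype.card_fin, nsmul_eq_mul]
  calc _ ≤ |∑ ν : Fin P.d, (if h : κ < ν then g ⟨x, κ, ν, h⟩ - g ⟨x.unshift ν, κ, ν, h⟩ else 0)|
        + |∑ μ : Fin P.d, (if h : μ < κ then g ⟨x.unshift μ, μ, κ, h⟩ - g ⟨x, μ, κ, h⟩ else 0)| := abs_add_le _ _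
    _ ≤ P.d * (2 * G) + P.d * (2 * G) := add_le_add h1 h2
    _ = 4 * P.d * G := by ring

/-- **`Q^{e*}` has `ℓ^∞ → ℓ^∞` size `L²`**: `|(Q^{e*}f)(p)| ≤ L²·|f(p′)|` with `p′ = ⟨blockOf p₋, μ, ν⟩` the coarse plaquette parallel to `p` over
the block of `p₋` — by (2.22) `(Q^{e*}f)(p) = L²f(p′)` if `p ∈ B^e(p′)` (then `p′` IS that plaquette, `mem_edgeB_iff`) and `0` otherwise.
[cite: BalabanImbrieJaffe1985, (2.22) p.305] -/
theorem abs_edgeQstar_le (hd : 2 ≤ P.d) (f : Balaban1983to89.Plaq P (j + 1) → ℝ) (p : Balaban1983to89.Plaq P j) :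
    |(torusEdgeCells P j hd).Qstar f p| ≤ (P.L : ℝ) ^ 2 * |f ⟨blockOf p.src, p.μ, p.ν, p.hμν⟩| := by
  by_cases h : ∃ p' : Balaban1983to89.Plaq P (j + 1), p ∈ (torusEdgeCells P j hd).B p'
  · obtain ⟨p', hp'⟩ := h
    have hid : p' = ⟨blockOf p.src, p.μ, p.ν, p.hμν⟩ := by
      obtain ⟨hμ, hν, hsrc, -, -⟩ := (mem_edgeB_iff hd p' p).1 hp'
      obtain ⟨y, μ', ν', h'⟩ := p'
      simp only at hμ hν hsrc
      subst hμ hν hsrc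
      rfl
    rw [(torusEdgeCells P j hd).Qstar_of_mem f hp', hid, abs_mul, abs_pow, Nat.abs_cast]
  · push Not at h
    rw [(torusEdgeCells P j hd).Qstar_of_not_mem f h, abs_zero]
    positivity

/-- kernel: a sum over the bonds of `T^{(j)}` of a function of the source = `d` times the site sum (`d = P.d`). [folklore] -/
private theorem sum_bond_src (F : Balaban1983to89.Site P j → ℝ) :
    ∑ b : PBond P j, F b.src = (P.d : ℝ) * ∑ y : Balaban1983to89.Site P j, F y := by
  rw [← Fintype.sum_equiv (LatticeFieldCalculus.bondEquiv (P := P) (j := j)) (fun q : Balaban1983to89.Site P j × Fin P.d => F q.1) _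
    (fun q => rfl), Fintype.sum_prod_type]
  simp only [Finset.sum_const, Finset.card_univ, Fintype.card_fin, nsmul_eq_mul]
  rw [Finset.mul_sum]

/-- kernel: the unit-lattice bond row sum of the (7.2.3)-shape, `Σ_{b′ ∈ T^{(j)*}} e^{−a|b₋ − b′₋|_∞} ≤ d·(2(1 + d/a))^d`, uniform in
the torus (site sum `B3TorusRadialSums.sum_exp_neg_supDist_le` over the `d` directions). [cite: Balaban1983Higgs3, (2.15) p.427] -/
private theorem sum_bond_exp_neg_supDist_le {a : ℝ} (ha : 0 < a) (b : PBond P j) :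
    ∑ b' : PBond P j, Real.exp (-(a * (supDist b.src b'.src : ℝ))) ≤ (P.d : ℝ) * (2 * (1 + P.d / a)) ^ P.d := by
  rw [sum_bond_src (fun y => Real.exp (-(a * (supDist b.src y : ℝ))))]
  exact mul_le_mul_of_nonneg_left (sum_exp_neg_supDist_le ha P.hd b.src) (Nat.cast_nonneg _)

/-- (3.27) read for `A^{(0)}`: `A^{(0)}_b = A′_b + Λ₄^{(0)*}(b)·L^{−2}·corr(b)` — the new variable in terms of the translated one, for r18's
typed `A′ = Aprime327 Λ₄* L A^{(0)} corr` over any correction `corr` (data). [cite: BalabanImbrieJaffe1988, (3.27) p.269] -/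
theorem a0_eq_aprime327_add (Λ₄s : Finset (PBond P j)) (L : ℝ) (A0 corr : PBond P j → ℝ) (b : PBond P j) :
    A0 b = Aprime327 Λ₄s L A0 corr b + if b ∈ Λ₄s then L ^ (-(2 : ℤ)) * corr b else 0 := by
  simp only [Aprime327, sub_add_cancel]

/-! ## §1  The size of the (3.27) correction: `C^{(0)}_{loc}`, `∂^*`, `Q^{e*}` are local and bounded -/

/-- **THE SIZE OF THE (3.27) CORRECTION `C^{(0)}_{loc}∂^*Q^{e*}f`, from a kernel bound** (p. 269 *"it is local"*; p. 297 (5.9.4) *"Since f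
is small and H_{k,loc} is regular"*): if `|C^{(0)}_{loc}(b,b′)| ≤ Me^{−δ|b−b′|_∞}` (`M ≥ 0`, `δ > 0`) and `|f(q)| ≤ F` for every coarse
plaquette `q` based at a block met within sup-distance `R + 4L + 1` of `b₋`, then
`|Σ_{b′}C^{(0)}_{loc}(b,b′)(∂^*Q^{e*}f)(b′)| ≤ M·d(2(1+d/δ))^d·4d·L²·F` — `C^{(0)}_{loc}` has range `R + 4L` (`cloc_eq_zero_of_far`) and summable
rows, `∂^*` reaches one step and costs `4d`, `Q^{e*}` costs `L²` (`d = P.d`). [cite: BalabanImbrieJaffe1988, (3.27) p.269] -/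
theorem abs_clocCorr_le_of_bound (hj : j + 1 ≤ P.m + P.K) (hd : 2 ≤ P.d) {M δ : ℝ} (hM : 0 ≤ M) (hδ : 0 < δ) {R : ℝ}
    (hC : ∀ b b' : PBond P j, |Cloc P j R b b'| ≤ M * Real.exp (-(δ * distB P j b b')))
    (f : Balaban1983to89.Plaq P (j + 1) → ℝ) (b : PBond P j) {F : ℝ} (hF : 0 ≤ F)
    (hf : ∀ q : Balaban1983to89.Plaq P (j + 1),
      (∃ x : Balaban1983to89.Site P j, (supDist b.src x : ℝ) ≤ R + 4 * P.L + 1 ∧ blockOf x = q.src) → |f q| ≤ F) :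
    |(Cloc P j R).mulVec (plaqDiv 1 ((torusEdgeCells P j hd).Qstar f)) b| ≤
      M * ((P.d : ℝ) * (2 * (1 + P.d / δ)) ^ P.d) * (4 * P.d) * ((P.L : ℝ) ^ 2 * F) := by
  set g : Balaban1983to89.Plaq P j → ℝ := (torusEdgeCells P j hd).Qstar f with hg_def
  set K : ℝ := 4 * P.d * ((P.L : ℝ) ^ 2 * F) with hK_def
  have hK : 0 ≤ K := by positivity
  -- `Q^{e*}` layer: `|g| ≤ L²F` on the fine plaquettes based within `R + 4L + 1` of `b₋`
  have hgp : ∀ p : Balaban1983to89.Plaq P j, (supDist b.src p.src : ℝ) ≤ R + 4 * P.L + 1 → |g p| ≤ (P.L : ℝ) ^ 2 * F := fun p hp =>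
    (abs_edgeQstar_le hd f p).trans (mul_le_mul_of_nonneg_left (hf _ ⟨p.src, hp, rfl⟩) (by positivity))
  -- `∂^*` layer: `|(∂^*g)(b′)| ≤ K` for `b′` within the range of `C^{(0)}_{loc}`
  have hD : ∀ b' : PBond P j, distB P j b b' ≤ R + 4 * P.L → |plaqDiv 1 g b'| ≤ K := by
    intro b' hb'
    obtain ⟨x, κ⟩ := b'
    have h := abs_plaqDiv_le_of_near 1 g x κ (G := (P.L : ℝ) ^ 2 * F) (by positivity) (fun p hp => hgp p (by
      have h1 : (supDist b.src p.src : ℝ) ≤ supDist b.src x + supDist x p.src := by exact_mod_cast supDist_triangle b.src x p.src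
      have h2 : (supDist x p.src : ℝ) ≤ 1 := by exact_mod_cast hp
      rw [distB_apply] at hb'
      change (supDist b.src x : ℝ) ≤ R + 4 * P.L at hb'
      linarith))
    rwa [abs_one, one_mul] at h
  -- termwise: `|C(b,b′)|·|(∂^*g)(b′)| ≤ |C(b,b′)|·K` (beyond the range `C(b,b′) = 0`)
  have hterm : ∀ b' : PBond P j, |Cloc P j R b b' * plaqDiv 1 g b'| ≤ |Cloc P j R b b'| * K := by
    intro b'
    rw [abs_mul]
    by_cases hnear : distB P j b b' ≤ R + 4 * P.L
    · exact mul_le_mul_of_nonneg_left (hD b' hnear) (abs_nonneg _)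
    · rw [cloc_eq_zero_of_far hj R (not_le.mp hnear), abs_zero, zero_mul, zero_mul]
  -- the row sum of `C^{(0)}_{loc}`
  have hrow : ∑ b' : PBond P j, |Cloc P j R b b'| ≤ M * ((P.d : ℝ) * (2 * (1 + P.d / δ)) ^ P.d) := by
    calc ∑ b' : PBond P j, |Cloc P j R b b'| ≤ ∑ b' : PBond P j, M * Real.exp (-(δ * distB P j b b')) := sum_le_sum fun b' _ => hC b b'
      _ = M * ∑ b' : PBond P j, Real.exp (-(δ * (supDist b.src b'.src : ℝ))) := by
          rw [Finset.mul_sum]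
          exact sum_congr rfl fun b' _ => by rw [distB_apply]
      _ ≤ M * ((P.d : ℝ) * (2 * (1 + P.d / δ)) ^ P.d) := mul_le_mul_of_nonneg_left (sum_bond_exp_neg_supDist_le hδ b) hM
  calc |(Cloc P j R).mulVec (plaqDiv 1 g) b| = |∑ b' : PBond P j, Cloc P j R b b' * plaqDiv 1 g b'| := rfl
    _ ≤ ∑ b' : PBond P j, |Cloc P j R b b' * plaqDiv 1 g b'| := abs_sum_le_sum_abs _ _
    _ ≤ ∑ b' : PBond P j, |Cloc P j R b b'| * K := sum_le_sum fun b' _ => hterm b'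
    _ = (∑ b' : PBond P j, |Cloc P j R b b'|) * K := by rw [Finset.sum_mul]
    _ ≤ M * ((P.d : ℝ) * (2 * (1 + P.d / δ)) ^ P.d) * K := mul_le_mul_of_nonneg_right hrow hK
    _ = M * ((P.d : ℝ) * (2 * (1 + P.d / δ)) ^ P.d) * (4 * P.d) * ((P.L : ℝ) ^ 2 * F) := by rw [hK_def]; ring

/-- **LOCALITY OF THE CORRECTION** (p. 269: *"However, it is local"*): `Σ_{b′}C^{(0)}_{loc}(b,b′)(∂^*Q^{e*}f)(b′)` vanishes when `f` vanishes on
the coarse plaquettes based at blocks met within sup-distance `R + 4L + 1` of `b₋` (hypothesis-free: p09's `cloc_decay`).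
[cite: BalabanImbrieJaffe1988, (3.27) p.269] -/
theorem clocCorr_eq_zero_of_far (hj : j + 1 ≤ P.m + P.K) (hd : 2 ≤ P.d) (R : ℝ) (f : Balaban1983to89.Plaq P (j + 1) → ℝ) (b : PBond P j)
    (hf : ∀ q : Balaban1983to89.Plaq P (j + 1),
      (∃ x : Balaban1983to89.Site P j, (supDist b.src x : ℝ) ≤ R + 4 * P.L + 1 ∧ blockOf x = q.src) → f q = 0) :
    (Cloc P j R).mulVec (plaqDiv 1 ((torusEdgeCells P j hd).Qstar f)) b = 0 := by
  obtain ⟨M', δ', hM', hδ', H⟩ := cloc_decay P.d P.L hd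
  have h := abs_clocCorr_le_of_bound hj hd hM'.le hδ' (fun u v => H P rfl rfl j inferInstance hj R u v) f b (F := 0) le_rfl
    (fun q hq => by rw [hf q hq, abs_zero])
  rw [mul_zero, mul_zero] at h
  exact abs_nonpos_iff.1 h

/-- **THE SIZE OF THE (3.27) CORRECTION, UNIFORM**: there is `C = C(d, L) > 0` such that on EVERY torus of these `(d, L)`, every
`j + 1 ≤ m + K`, every truncation radius `R`, every coarse plaquette function `f` and every bond `b`:
`|Σ_{b′}C^{(0)}_{loc}(b,b′)(∂^*Q^{e*}f)(b′)| ≤ C·L²·F` whenever `|f(q)| ≤ F` (`F ≥ 0`) for the coarse plaquettes `q` based at a block met within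
sup-distance `R + 4L + 1` of `b₋` (p09's hypothesis-free `cloc_decay` for the kernel bound). [cite: BalabanImbrieJaffe1988, (3.27) p.269] -/
theorem clocCorr_bound (d L : ℕ) (hd : 2 ≤ d) :
    ∃ C : ℝ, 0 < C ∧ ∀ (P : Params) (hPd : 2 ≤ P.d), P.d = d → P.L = L → ∀ (j : ℕ),
      j + 1 ≤ P.m + P.K → ∀ (R : ℝ) (f : Balaban1983to89.Plaq P (j + 1) → ℝ) (b : PBond P j) (F : ℝ), 0 ≤ F →
        (∀ q : Balaban1983to89.Plaq P (j + 1),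
          (∃ x : Balaban1983to89.Site P j, (supDist b.src x : ℝ) ≤ R + 4 * L + 1 ∧ blockOf x = q.src) → |f q| ≤ F) →
        |(Cloc P j R).mulVec (plaqDiv 1 ((torusEdgeCells P j hPd).Qstar f)) b| ≤ C * (L : ℝ) ^ 2 * F := by
  obtain ⟨M', δ', hM', hδ', H⟩ := cloc_decay d L hd
  have hd0 : (0 : ℝ) < d := by exact_mod_cast (show 0 < d by omega)
  refine ⟨M' * ((d : ℝ) * (2 * (1 + d / δ')) ^ d) * (4 * d), by positivity, fun P hPd hP hPL j hj R f b F hF hf => ?_⟩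
  have hC : ∀ u v : PBond P j, |Cloc P j R u v| ≤ M' * Real.exp (-(δ' * distB P j u v)) := fun u v => H P hP hPL j inferInstance hj R u v
  subst hP hPL
  calc _ ≤ M' * ((P.d : ℝ) * (2 * (1 + P.d / δ')) ^ P.d) * (4 * P.d) * ((P.L : ℝ) ^ 2 * F) :=
        abs_clocCorr_le_of_bound hj hPd hM'.le hδ' hC f b hF hf
    _ = M' * ((P.d : ℝ) * (2 * (1 + P.d / δ')) ^ P.d) * (4 * P.d) * (P.L : ℝ) ^ 2 * F := by ring

/-! ## §2  (3.33), the gauge-field half: `|A^{(0)}_b| ≤ cp(e₀)` on `Λ₁^{(0)*}` -/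

/-- kernel: `L^{−2}·(X·(L²·F)) = X·F` for the block size `L ≥ 2`. [folklore] -/
private theorem zpow_neg_two_mul_cancel (X F : ℝ) : (P.L : ℝ) ^ (-(2 : ℤ)) * (X * ((P.L : ℝ) ^ 2 * F)) = X * F := by
  have hL : (P.L : ℝ) ≠ 0 := P.cast_L_pos.ne'
  rw [zpow_neg, zpow_ofNat]
  field_simp

/-- **(3.33) p. 270 [PDF 14], THE GAUGE-FIELD HALF, over an ABSTRACT correction**: if `A′ = A^{(0)} − Λ₄*L^{−2}corr` (r18's `Aprime327`)
satisfies `|A′_b| ≤ c₁p(e₀)` on `Λ₁*` (r16's `SmallAPrime`, p. 269) and the correction is small, `|corr(b)| ≤ X·L²·c₂p(e₀)` on `Λ₁* ∩ Λ₄*`,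
then *"|A^{(0)}| ≦ cp(e₀) in Λ₁^{(0)*}"* with `c = c₁ + Xc₂`. [cite: BalabanImbrieJaffe1988, (3.33) p.270] -/
theorem small333_gauge_of_corr {Λ₁s Λ₄s : Finset (PBond P j)} {A0 corr : PBond P j → ℝ} {c₁ c₂ X pe₀ : ℝ}
    (hpe : 0 ≤ pe₀) (hc₂ : 0 ≤ c₂) (hX : 0 ≤ X)
    (hA' : SmallAPrime c₁ pe₀ Λ₁s (Aprime327 Λ₄s (P.L : ℝ) A0 corr))
    (hcorr : ∀ b ∈ Λ₁s, b ∈ Λ₄s → |corr b| ≤ X * ((P.L : ℝ) ^ 2 * (c₂ * pe₀))) :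
    ∀ b ∈ Λ₁s, |A0 b| ≤ (c₁ + X * c₂) * pe₀ := by
  intro b hb
  have hA : |Aprime327 Λ₄s (P.L : ℝ) A0 corr b| ≤ c₁ * pe₀ := hA' b hb
  have hrest : c₁ * pe₀ ≤ (c₁ + X * c₂) * pe₀ := by nlinarith [mul_nonneg (mul_nonneg hX hc₂) hpe]
  rw [a0_eq_aprime327_add Λ₄s (P.L : ℝ) A0 corr b]
  by_cases h4 : b ∈ Λ₄s
  · rw [if_pos h4]
    have hL2 : 0 ≤ (P.L : ℝ) ^ (-(2 : ℤ)) := by positivity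
    calc |Aprime327 Λ₄s (P.L : ℝ) A0 corr b + (P.L : ℝ) ^ (-(2 : ℤ)) * corr b|
        ≤ |Aprime327 Λ₄s (P.L : ℝ) A0 corr b| + |(P.L : ℝ) ^ (-(2 : ℤ)) * corr b| := abs_add_le _ _
      _ ≤ c₁ * pe₀ + (P.L : ℝ) ^ (-(2 : ℤ)) * (X * ((P.L : ℝ) ^ 2 * (c₂ * pe₀))) := by
          rw [abs_mul, abs_of_nonneg hL2]
          exact add_le_add hA (mul_le_mul_of_nonneg_left (hcorr b hb h4) hL2)
      _ = (c₁ + X * c₂) * pe₀ := by rw [zpow_neg_two_mul_cancel]; ring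
  · rw [if_neg h4, add_zero]
    exact hA.trans hrest

/-- **(3.33) p. 270 [PDF 14], THE GAUGE-FIELD HALF, for the correction OF RECORD `C^{(0)}_{loc}∂^*Q^{e*}f`, from a kernel bound**:
*"Similarly, it can be shown that |A^{(0)}| ≦ cp(e₀) in Λ₁^{(0)*}"* — with `A^{(0)}` tied to `A′` by (3.27)
(`A′ = Aprime327 Λ₄* L A^{(0)} (C^{(0)}_{loc}∂^*Q^{e*}f)`): if `|C^{(0)}_{loc}(b,b′)| ≤ Me^{−δ|b−b′|_∞}`, `|A′_b| ≤ c₁p(e₀)` on `Λ₁*` (r16's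
`SmallAPrime`, p. 269), `|f(q)| ≤ c₂p(e₀)` on `Λ₀′**` ((3.15)) and every coarse plaquette based at a block met within sup-distance `R + 4L + 1` of
a bond of `Λ₁* ∩ Λ₄*` lies in `Λ₀′**` (the located margin), then `|A^{(0)}_b| ≤ (c₁ + M·d(2(1+d/δ))^d·4d·c₂)·p(e₀)` for every `b ∈ Λ₁*`.
[cite: BalabanImbrieJaffe1988, (3.33) p.270] -/
theorem small333_gauge_of_bound (hj : j + 1 ≤ P.m + P.K) (hd : 2 ≤ P.d) {M δ : ℝ} (hM : 0 ≤ M) (hδ : 0 < δ) {R : ℝ}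
    (hC : ∀ b b' : PBond P j, |Cloc P j R b b'| ≤ M * Real.exp (-(δ * distB P j b b')))
    {Λ₁s Λ₄s : Finset (PBond P j)} {Λ₀' : Finset (Balaban1983to89.Site P (j + 1))} {f : Balaban1983to89.Plaq P (j + 1) → ℝ}
    {A0 : PBond P j → ℝ} {c₁ c₂ pe₀ : ℝ} (hpe : 0 ≤ pe₀) (hc₂ : 0 ≤ c₂)
    (hA' : SmallAPrime c₁ pe₀ Λ₁s (Aprime327 Λ₄s (P.L : ℝ) A0 ((Cloc P j R).mulVec (plaqDiv 1 ((torusEdgeCells P j hd).Qstar f)))))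
    (hfΛ : ∀ q ∈ starP Λ₀', |f q| ≤ c₂ * pe₀)
    (hmargin : ∀ b ∈ Λ₁s, b ∈ Λ₄s → ∀ x : Balaban1983to89.Site P j, (supDist b.src x : ℝ) ≤ R + 4 * P.L + 1 →
      ∀ q : Balaban1983to89.Plaq P (j + 1), q.src = blockOf x → q ∈ starP Λ₀') :
    ∀ b ∈ Λ₁s, |A0 b| ≤ (c₁ + M * ((P.d : ℝ) * (2 * (1 + P.d / δ)) ^ P.d) * (4 * P.d) * c₂) * pe₀ :=
  small333_gauge_of_corr hpe hc₂ (by positivity) hA' fun b hb h4 =>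
    abs_clocCorr_le_of_bound hj hd hM hδ hC f b (mul_nonneg hc₂ hpe) fun q ⟨x, hx, hq⟩ => hfΛ q (hmargin b hb h4 x hx q hq.symm)

/-- **(3.33) p. 270 [PDF 14], THE GAUGE-FIELD HALF — UNIFORM FORM**: there is `C = C(d, L) > 0` such that on EVERY torus of these
`(d, L)`, every `j + 1 ≤ m + K` and every truncation radius `R`: if `|A′_b| ≤ c₁p(e₀)` on `Λ₁*` (r16's
`SmallAPrime c₁ pe₀ Λ₁* (Aprime327 Λ₄* L A^{(0)} (C^{(0)}_{loc}∂^*Q^{e*}f))` — the translated variable of (3.27) is small, p. 269), `|f(q)| ≤ c₂p(e₀)`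
on `Λ₀′**` ((3.15) via (3.26)) and every coarse plaquette based at a block met within sup-distance `R + 4L + 1` of a bond of `Λ₁* ∩ Λ₄*` lies
in `Λ₀′**` (located margin: `Λ₁^{(0)} = Λ₀^{(0)}` minus `r(e₀)`-cubes, `R = ¼r(e₀)`), then *"|A^{(0)}| ≦ cp(e₀) in Λ₁^{(0)*}"* with
`c = c₁ + C·c₂`: `∀ b ∈ Λ₁*, |A^{(0)}_b| ≤ (c₁ + C·c₂)·p(e₀)` — the first clause of r18's `Small333` on the bonds of `Λ₁*`.
[cite: BalabanImbrieJaffe1988, (3.33) p.270] -/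
theorem small333_gauge (d L : ℕ) (hd : 2 ≤ d) :
    ∃ C : ℝ, 0 < C ∧ ∀ (P : Params) (hPd : 2 ≤ P.d), P.d = d → P.L = L → ∀ (j : ℕ),
      j + 1 ≤ P.m + P.K → ∀ (R : ℝ) (Λ₁s Λ₄s : Finset (PBond P j)) (Λ₀' : Finset (Balaban1983to89.Site P (j + 1)))
        (f : Balaban1983to89.Plaq P (j + 1) → ℝ) (A0 : PBond P j → ℝ) (c₁ c₂ pe₀ : ℝ), 0 ≤ pe₀ → 0 ≤ c₂ →
        SmallAPrime c₁ pe₀ Λ₁s (Aprime327 Λ₄s (L : ℝ) A0 ((Cloc P j R).mulVec (plaqDiv 1 ((torusEdgeCells P j hPd).Qstar f)))) →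
        (∀ q ∈ starP Λ₀', |f q| ≤ c₂ * pe₀) →
        (∀ b ∈ Λ₁s, b ∈ Λ₄s → ∀ x : Balaban1983to89.Site P j, (supDist b.src x : ℝ) ≤ R + 4 * L + 1 →
          ∀ q : Balaban1983to89.Plaq P (j + 1), q.src = blockOf x → q ∈ starP Λ₀') →
        ∀ b ∈ Λ₁s, |A0 b| ≤ (c₁ + C * c₂) * pe₀ := by
  obtain ⟨M', δ', hM', hδ', H⟩ := cloc_decay d L hd
  have hd0 : (0 : ℝ) < d := by exact_mod_cast (show 0 < d by omega)
  refine ⟨M' * ((d : ℝ) * (2 * (1 + d / δ')) ^ d) * (4 * d), by positivity,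
    fun P hPd hP hPL j hj R Λ₁s Λ₄s Λ₀' f A0 c₁ c₂ pe₀ hpe hc₂ hA' hfΛ hmargin b hb => ?_⟩
  have hC : ∀ u v : PBond P j, |Cloc P j R u v| ≤ M' * Real.exp (-(δ' * distB P j u v)) := fun u v => H P hP hPL j inferInstance hj R u v
  subst hP hPL
  exact small333_gauge_of_bound hj hPd hM'.le hδ' hC hpe hc₂ hA' hfΛ hmargin b hb

/-! ## §3  The size of the p. 270 correction factor of the background `u₁` -/

/-- **THE p. 270 CORRECTION FACTOR OF `u₁`, SIZE** (the display after (3.28): `u₁ = (Λ₁*Q^{s*}v)(Λ₆^{*c}u^{(0)})exp(∓ie₀Λ₄*L^{−2}C^{(0)}_{loc}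
∂^*Q^{e*}f)`; sign as in (3.28)/(4.2), the third factor of r18's `u1bg`): under the kernel bound and `|f| ≤ c₂p(e₀)` on the coarse plaquettes
based at blocks met within sup-distance `R + 4L + 1` of `b₋`,
`‖exp(−ie₀L^{−2}Σ_{b′}C^{(0)}_{loc}(b,b′)(∂^*Q^{e*}f)(b′)) − 1‖ ≤ e₀·M·d(2(1+d/δ))^d·4d·c₂·p(e₀)` — the size modulo which the `D_{ū₁}ψ` clause
of (3.32) is stated for `v = Qu` (p30's `BIJ88SmallBlockFields332`). [cite: BalabanImbrieJaffe1988, (3.28) p.270] -/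
theorem norm_corrPhase_sub_one_le (hj : j + 1 ≤ P.m + P.K) (hd : 2 ≤ P.d) {M δ : ℝ} (hM : 0 ≤ M) (hδ : 0 < δ) {R : ℝ}
    (hC : ∀ b b' : PBond P j, |Cloc P j R b b'| ≤ M * Real.exp (-(δ * distB P j b b')))
    {f : Balaban1983to89.Plaq P (j + 1) → ℝ} {c₂ pe₀ e₀ : ℝ} (hpe : 0 ≤ pe₀) (hc₂ : 0 ≤ c₂) (he : 0 ≤ e₀) (b : PBond P j)
    (hf : ∀ q : Balaban1983to89.Plaq P (j + 1),
      (∃ x : Balaban1983to89.Site P j, (supDist b.src x : ℝ) ≤ R + 4 * P.L + 1 ∧ blockOf x = q.src) → |f q| ≤ c₂ * pe₀) :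
    ‖Complex.exp (-(Complex.I *
        ((e₀ * ((P.L : ℝ) ^ (-(2 : ℤ)) * (Cloc P j R).mulVec (plaqDiv 1 ((torusEdgeCells P j hd).Qstar f)) b) : ℝ) : ℂ))) - 1‖ ≤
      e₀ * (M * ((P.d : ℝ) * (2 * (1 + P.d / δ)) ^ P.d) * (4 * P.d) * c₂) * pe₀ := by
  set X : ℝ := M * ((P.d : ℝ) * (2 * (1 + P.d / δ)) ^ P.d) * (4 * P.d) with hX_def
  set corr : ℝ := (Cloc P j R).mulVec (plaqDiv 1 ((torusEdgeCells P j hd).Qstar f)) b with hcorr_def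
  have hcorr : |corr| ≤ X * ((P.L : ℝ) ^ 2 * (c₂ * pe₀)) :=
    abs_clocCorr_le_of_bound hj hd hM hδ hC f b (mul_nonneg hc₂ hpe) hf
  have hL2 : 0 ≤ (P.L : ℝ) ^ (-(2 : ℤ)) := by positivity
  have hrw : -(Complex.I * ((e₀ * ((P.L : ℝ) ^ (-(2 : ℤ)) * corr) : ℝ) : ℂ)) =
      Complex.I * ((-(e₀ * ((P.L : ℝ) ^ (-(2 : ℤ)) * corr)) : ℝ) : ℂ) := by
    push_cast
    ring
  rw [hrw]
  refine (Real.norm_exp_I_mul_ofReal_sub_one_le).trans ?_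
  rw [Real.norm_eq_abs, abs_neg, abs_mul, abs_of_nonneg he, abs_mul, abs_of_nonneg hL2]
  calc e₀ * ((P.L : ℝ) ^ (-(2 : ℤ)) * |corr|) ≤ e₀ * ((P.L : ℝ) ^ (-(2 : ℤ)) * (X * ((P.L : ℝ) ^ 2 * (c₂ * pe₀)))) :=
        mul_le_mul_of_nonneg_left (mul_le_mul_of_nonneg_left hcorr hL2) he
    _ = e₀ * (X * c₂) * pe₀ := by rw [zpow_neg_two_mul_cancel]; ring

/-- **THE p. 270 CORRECTION FACTOR OF `u₁`, UNIFORM SIZE**: with the constant `C = C(d, L)` of `clocCorr_bound`,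
`‖exp(−ie₀L^{−2}Σ_{b′}C^{(0)}_{loc}(b,b′)(∂^*Q^{e*}f)(b′)) − 1‖ ≤ e₀·C·c₂·p(e₀)` whenever `|f(q)| ≤ c₂p(e₀)` on the coarse plaquettes based at
blocks met within sup-distance `R + 4L + 1` of `b₋` (`e₀, c₂, p(e₀) ≥ 0`). [cite: BalabanImbrieJaffe1988, (3.28) p.270] -/
theorem norm_corrPhase_sub_one_le_uniform (d L : ℕ) (hd : 2 ≤ d) :
    ∃ C : ℝ, 0 < C ∧ ∀ (P : Params) (hPd : 2 ≤ P.d), P.d = d → P.L = L → ∀ (j : ℕ),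
      j + 1 ≤ P.m + P.K → ∀ (R : ℝ) (f : Balaban1983to89.Plaq P (j + 1) → ℝ) (c₂ pe₀ e₀ : ℝ) (b : PBond P j),
        0 ≤ pe₀ → 0 ≤ c₂ → 0 ≤ e₀ →
        (∀ q : Balaban1983to89.Plaq P (j + 1),
          (∃ x : Balaban1983to89.Site P j, (supDist b.src x : ℝ) ≤ R + 4 * L + 1 ∧ blockOf x = q.src) → |f q| ≤ c₂ * pe₀) →
        ‖Complex.exp (-(Complex.I *
            ((e₀ * ((L : ℝ) ^ (-(2 : ℤ)) * (Cloc P j R).mulVec (plaqDiv 1 ((torusEdgeCells P j hPd).Qstar f)) b) : ℝ) : ℂ))) - 1‖ ≤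
          e₀ * (C * c₂) * pe₀ := by
  obtain ⟨M', δ', hM', hδ', H⟩ := cloc_decay d L hd
  have hd0 : (0 : ℝ) < d := by exact_mod_cast (show 0 < d by omega)
  refine ⟨M' * ((d : ℝ) * (2 * (1 + d / δ')) ^ d) * (4 * d), by positivity,
    fun P hPd hP hPL j hj R f c₂ pe₀ e₀ b hpe hc₂ he hf => ?_⟩
  have hC : ∀ u v : PBond P j, |Cloc P j R u v| ≤ M' * Real.exp (-(δ' * distB P j u v)) := fun u v => H P hP hPL j inferInstance hj R u v
  subst hP hPL
  exact norm_corrPhase_sub_one_le hj hPd hM'.le hδ' hC hpe hc₂ he b hf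

/-! ## §4  The plaquette-level instance: p31's two theorems feed §2 -/

section Plaquettes

open BIJ88Sect3Statements (U1 toC fieldStrength)
open BIJ85Sect1Model (argB)
open BIJ88RenormTransf311 (DeltaAx)
open BIJ85BlockAveragesTorus (qU uPrime)
open GaugeField (plaqHol)
open BIJ88Eq531SmallAPrime (smallAPrime_of_plaquettes)
open BIJ88Eq531SmallF (smallF_of_plaquettes)

/-- **(3.33), GAUGE-FIELD HALF, FROM THE RESTRICTIONS ON THE PLAQUETTE VARIABLES** (p. 269 *"From the restrictions on the fields, we have
that u′_b = e^{ie₀A′_b}, with |A′_b| ≦ cp(e₀) in Λ₁^{(0)*}"* + (3.26)/(3.15) *"|f^{(0)}(p)| ≦ p(e₀)"* ⟹ p. 270 *"|A^{(0)}| ≦ cp(e₀) in Λ₁^{(0)*}"*):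
for a `U(1)` field `u` in the axial gauge `δ_{Ax}` of (3.11) with `|arg u(p)| ≤ e₀p(e₀)` on the fine plaquettes of the two blocks met by each bond
of `Λ₁*` and of the four blocks around each coarse plaquette of `Λ₀′**`, `17d²L²·e₀p(e₀) < π`, print's `A′_b = arg(u′_b)/e₀` (p31's
`smallAPrime_of_plaquettes`, `c = 6d²L²`) and `f = Re (ie₀)^{−1}log v(∂·)`, `v = Qu` (p31's `smallF_of_plaquettes`, `c = 17d²L²`), any
`A^{(0)}` tied to this `A′` by (3.27) with the correction of record, and the located margin of §2: under a kernel bound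
`|C^{(0)}_{loc}(b,b′)| ≤ Me^{−δ|b−b′|_∞}`, `|A^{(0)}_b| ≤ (6 + M·d(2(1+d/δ))^d·4d·17)d²L²·p(e₀)` on `Λ₁*`.
[cite: BalabanImbrieJaffe1988, (3.33) p.270] -/
theorem small333_gauge_of_plaquettes (hj : j + 1 ≤ P.m + P.K) (hd : 2 ≤ P.d) {M δ : ℝ} (hM : 0 ≤ M) (hδ : 0 < δ) {R : ℝ}
    (hC : ∀ b b' : PBond P j, |Cloc P j R b b'| ≤ M * Real.exp (-(δ * distB P j b b')))
    {U : GaugeField P j U1} (hU : DeltaAx U) {e₀ pe₀ : ℝ} (he : 0 < e₀) (hpe : 0 ≤ pe₀)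
    (Λ₁s Λ₄s : Finset (PBond P j)) (Λ₀' : Finset (Balaban1983to89.Site P (j + 1)))
    (hεA : ∀ b ∈ Λ₁s, ∀ p : Balaban1983to89.Plaq P j,
      blockOf p.src = blockOf b.src ∨ blockOf p.src = (blockOf b.src).shift b.dir → |argB (toC (plaqHol U p))| ≤ e₀ * pe₀)
    (hεF : ∀ q ∈ starP Λ₀', ∀ p : Balaban1983to89.Plaq P j, blockOf p.src = q.src ∨ blockOf p.src = q.src.shift q.μ ∨
      blockOf p.src = q.src.shift q.ν ∨ blockOf p.src = (q.src.shift q.μ).shift q.ν → |argB (toC (plaqHol U p))| ≤ e₀ * pe₀)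
    (hπ : 17 * (P.d : ℝ) ^ 2 * (P.L : ℝ) ^ 2 * (e₀ * pe₀) < Real.pi)
    (hmargin : ∀ b ∈ Λ₁s, b ∈ Λ₄s → ∀ x : Balaban1983to89.Site P j, (supDist b.src x : ℝ) ≤ R + 4 * P.L + 1 →
      ∀ q : Balaban1983to89.Plaq P (j + 1), q.src = blockOf x → q ∈ starP Λ₀')
    (A0 : PBond P j → ℝ)
    (h327 : Aprime327 Λ₄s (P.L : ℝ) A0 ((Cloc P j R).mulVec (plaqDiv 1 ((torusEdgeCells P j hd).Qstar
        (fun q => (fieldStrength e₀ (toC (plaqHol (qU U) q))).re)))) = fun b => argB (toC (uPrime U b)) / e₀) :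
    ∀ b ∈ Λ₁s, |A0 b| ≤ (6 * (P.d : ℝ) ^ 2 * (P.L : ℝ) ^ 2 +
      M * ((P.d : ℝ) * (2 * (1 + P.d / δ)) ^ P.d) * (4 * P.d) * (17 * (P.d : ℝ) ^ 2 * (P.L : ℝ) ^ 2)) * pe₀ := by
  have hπ6 : 6 * (P.d : ℝ) ^ 2 * (P.L : ℝ) ^ 2 * (e₀ * pe₀) < Real.pi := by
    have h0 : 0 ≤ (P.d : ℝ) ^ 2 * (P.L : ℝ) ^ 2 * (e₀ * pe₀) := by positivity
    nlinarith
  have hA' : SmallAPrime (6 * (P.d : ℝ) ^ 2 * (P.L : ℝ) ^ 2) pe₀ Λ₁s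
      (Aprime327 Λ₄s (P.L : ℝ) A0 ((Cloc P j R).mulVec (plaqDiv 1 ((torusEdgeCells P j hd).Qstar
        (fun q => (fieldStrength e₀ (toC (plaqHol (qU U) q))).re))))) := by
    rw [h327]
    exact smallAPrime_of_plaquettes hj hU he hpe Λ₁s hεA hπ6
  have hF := smallF_of_plaquettes hj hU he hpe Λ₀' hεF hπ
  have hfΛ : ∀ q ∈ starP Λ₀', |(fieldStrength e₀ (toC (plaqHol (qU U) q))).re| ≤ 17 * (P.d : ℝ) ^ 2 * (P.L : ℝ) ^ 2 * pe₀ :=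
    fun q hq => (Complex.abs_re_le_norm _).trans (hF q hq)
  exact small333_gauge_of_bound hj hd hM hδ hC hpe (by positivity) hA' hfΛ hmargin

end Plaquettes

/-- **(3.33), GAUGE-FIELD HALF, FROM THE PLAQUETTE RESTRICTIONS — UNIFORM FORM**: there is `c = c(d, L) > 0` such that on every torus of
these `(d, L)`, every `j + 1 ≤ m + K` and every `R`, for a `U(1)` field in the axial gauge whose fine plaquettes near `Λ₁*` and around `Λ₀′**` obey
`|arg u(p)| ≤ e₀p(e₀)` (`17d²L²e₀p(e₀) < π`), print's `A′ = arg(u′)/e₀`, `f = Re (ie₀)^{−1}log(Qu)(∂·)`, any `A^{(0)}` tied to `A′` by (3.27) with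
the correction of record, and the located margin: *"|A^{(0)}| ≦ cp(e₀) in Λ₁^{(0)*}"*, `∀ b ∈ Λ₁*, |A^{(0)}_b| ≤ c·p(e₀)`.
[cite: BalabanImbrieJaffe1988, (3.33) p.270] -/
theorem small333_gauge_of_plaquettes_uniform (d L : ℕ) (hd : 2 ≤ d) :
    ∃ c : ℝ, 0 < c ∧ ∀ (P : Params) (hPd : 2 ≤ P.d), P.d = d → P.L = L → ∀ (j : ℕ), j + 1 ≤ P.m + P.K →
      ∀ (R : ℝ) (U : GaugeField P j BIJ88Sect3Statements.U1), BIJ88RenormTransf311.DeltaAx U → ∀ (e₀ pe₀ : ℝ), 0 < e₀ → 0 ≤ pe₀ →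
      ∀ (Λ₁s Λ₄s : Finset (PBond P j)) (Λ₀' : Finset (Balaban1983to89.Site P (j + 1))),
      (∀ b ∈ Λ₁s, ∀ p : Balaban1983to89.Plaq P j, blockOf p.src = blockOf b.src ∨ blockOf p.src = (blockOf b.src).shift b.dir →
        |BIJ85Sect1Model.argB (BIJ88Sect3Statements.toC (GaugeField.plaqHol U p))| ≤ e₀ * pe₀) →
      (∀ q ∈ starP Λ₀', ∀ p : Balaban1983to89.Plaq P j, blockOf p.src = q.src ∨ blockOf p.src = q.src.shift q.μ ∨
        blockOf p.src = q.src.shift q.ν ∨ blockOf p.src = (q.src.shift q.μ).shift q.ν →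
        |BIJ85Sect1Model.argB (BIJ88Sect3Statements.toC (GaugeField.plaqHol U p))| ≤ e₀ * pe₀) →
      17 * (d : ℝ) ^ 2 * (L : ℝ) ^ 2 * (e₀ * pe₀) < Real.pi →
      (∀ b ∈ Λ₁s, b ∈ Λ₄s → ∀ x : Balaban1983to89.Site P j, (supDist b.src x : ℝ) ≤ R + 4 * L + 1 →
        ∀ q : Balaban1983to89.Plaq P (j + 1), q.src = blockOf x → q ∈ starP Λ₀') →
      ∀ (A0 : PBond P j → ℝ), Aprime327 Λ₄s (L : ℝ) A0 ((Cloc P j R).mulVec (plaqDiv 1 ((torusEdgeCells P j hPd).Qstar (fun q =>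
        (BIJ88Sect3Statements.fieldStrength e₀ (BIJ88Sect3Statements.toC (GaugeField.plaqHol (BIJ85BlockAveragesTorus.qU U) q))).re)))) =
        (fun b => BIJ85Sect1Model.argB (BIJ88Sect3Statements.toC (BIJ85BlockAveragesTorus.uPrime U b)) / e₀) →
      ∀ b ∈ Λ₁s, |A0 b| ≤ c * pe₀ := by
  obtain ⟨M', δ', hM', hδ', H⟩ := cloc_decay d L hd
  have hd0 : (0 : ℝ) < d := by exact_mod_cast (show 0 < d by omega)
  refine ⟨1 + (6 * (d : ℝ) ^ 2 * (L : ℝ) ^ 2 + M' * ((d : ℝ) * (2 * (1 + d / δ')) ^ d) * (4 * d) * (17 * (d : ℝ) ^ 2 * (L : ℝ) ^ 2)),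
    by positivity, fun P hPd hP hPL j hj R U hU e₀ pe₀ he hpe Λ₁s Λ₄s Λ₀' hεA hεF hπ hmargin A0 h327 b hb => ?_⟩
  have hC : ∀ u v : PBond P j, |Cloc P j R u v| ≤ M' * Real.exp (-(δ' * distB P j u v)) := fun u v => H P hP hPL j inferInstance hj R u v
  subst hP hPL
  exact (small333_gauge_of_plaquettes hj hPd hM'.le hδ' hC hU he hpe Λ₁s Λ₄s Λ₀' hεA hεF hπ hmargin A0 h327 b hb).trans
    (mul_le_mul_of_nonneg_right (le_add_of_nonneg_left zero_le_one) hpe)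

end

end Literature.MathematicalPhysics.QuantumFieldTheory.BalabanImbrieJaffe1984to88.BIJ88Small333GaugeField
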